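import Summits.AtomisticToContinuum.BoseEinsteinCondensation.Theorems.BECConjugateDominationIMUChainGlueKernelBound
import HarnessLib

/-!
# Route `BECConjugateDomination`, crux `InfraredMinimumUncertainty` (stmt-AtomisticToContinuum-11784) —
# helper: the Lévy–Jensen–Parseval bound of the glue at the FREE scale (`νₙ ≤ B₁ + B₃/‖n‖²`)

The glue `IMUChainGlue` (stmt-11790, `Theorems/BECConjugateDominationIMUChainGlue*.lean`) feeds the
Jensen–Parseval bound `KernelBound.log_sub_le_setAverage_log` with a Lévy-weight majorant of the shape
`νₙ ≤ B₁ + B₂/‖n‖` — the shape produced by `InfraredMinimumUncertainty ∧ PuffFloor` (phonon scale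
`ν ≲ √ρ/(N‖k‖)` in the infrared).  This file proves the same bound for the WEAKER, free-scale shape
`νₙ ≤ B₁ + B₃/‖n‖²` (`ν ≲ ρ/(N‖k‖²)` in the infrared), which is what the floor-free law
`LevyFreeScaleLaw` (`N‖k‖²ν_m ≤ C(‖k‖² + ρ)`, file `…InfraredMinimumUncertaintyFreeScaleLaw.lean`) supplies:

* `sum_cube_inv_supNorm_sq_le` : `∑_{0 < ‖n‖∞ ≤ M} 1/‖n‖∞² ≤ 26 M` (the `d = 3` shell count
  `#{‖n‖∞ = j} ≤ 26 j²`, now against `1/j²`: the infrared sum `∑_{|k| ≲ κ} 1/|k|²` is `O(κ)` per unit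
  volume in `d = 3`);
* `sum_weight_div_norm_sq_le` / `tsum_weight_div_norm_sq_le` : for a weight `0 ≤ c ≤ 1` with
  `∑ ‖n‖² cₙ = A'`, `∑_{n ≠ 0} cₙ/‖n‖² ≤ 26 M + A'/M⁴`;
* `log_sub_le_setAverage_log_sq`, `mul_exp_neg_le_setAverage_sq` : under `νₙ ≤ B₁ + B₃/‖n‖²` the cell
  average of `log g` (resp. of `g`) is bounded below with error
  `B₁ · 8Q₀L³/a³ + B₃ · (52 + 2Q₁/π²) L/a` (resp. `θ e^{−error}`).

Everything else (Parseval against the eight-corner kernel, Jensen) is reused from the `KernelBound` file.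
-/

noncomputable section

open MeasureTheory Set Complex Filter
open scoped ENNReal NNReal Topology ComplexConjugate

namespace Summit.AtomisticToContinuum.BoseEinsteinCondensation.Theorems.IMUChainGlue

open Literature.MathematicalPhysics.QuantumManyBody.BoseGas

/-- The sup norm `‖n‖∞ = maxⱼ |nⱼ| ∈ ℕ` of `n ∈ ℤ³` (local notation, as in the `Lattice` file). -/
local notation "supNorm⟦" n "⟧" => Finset.sup Finset.univ (fun i : Fin 3 => Int.natAbs (n i))

/-- The cube `{-M,…,M}³ ⊂ ℤ³` (local notation, as in the `Lattice` file). -/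
local notation "cube⟦" M "⟧" => Finset.Icc (-((M : ℕ) : Fin 3 → ℤ)) ((M : ℕ) : Fin 3 → ℤ)

/-- The eight corners `{0,1}³ ⊂ ℤ³` (local notation, as in the `Corners` file). -/
local notation "corners" => (Fintype.piFinset fun _ : Fin 3 => ({0, 1} : Finset ℤ))

/-- The fixed profile (local notation, as in the `Bump` file). -/
local notation "χ" => (ContDiffBump.normed
  (ContDiffBump.mk 1 2 one_pos one_lt_two : ContDiffBump (0 : Space)) volume)

/-- The scaled bump, value form (local notation, as in the `Bump` file). -/
local notation "ηv⟦" a ", " x "⟧" => (a ^ 3)⁻¹ * χ (a⁻¹ • x)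

/-- The autocorrelation of the scaled bump (local notation, as in the `Kernel` file). -/
local notation "φ₀v⟦" a ", " s "⟧" => ∫ x : Space, ηv⟦a, x + s⟧ * ηv⟦a, x⟧

/-- `Q₀ = ∫ χ²` (local notation). -/
local notation "Q₀" => ∫ y : Space, (χ y) ^ 2

/-- `Q₁ = ∑ⱼ ∫ |∂ⱼχ|²` (local notation). -/
local notation "Q₁" => ∑ j : Fin 3, ∫ y : Space, (fderiv ℝ χ y (EuclideanSpace.single j 1)) ^ 2

/-! ### Lattice-point counting against `1/‖n‖²` in `d = 3` -/

/-- **The infrared shell count against `1/‖n‖∞²`**: `∑_{0 < ‖n‖∞ ≤ M} 1/‖n‖∞² ≤ 26 M`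
(shell by shell: `#{‖n‖∞ = j} = (2j+1)³ − (2j−1)³ ≤ 26 j²`, each term `1/j²`). -/
theorem sum_cube_inv_supNorm_sq_le (M : ℕ) :
    ∑ n ∈ cube⟦M⟧, (if n = 0 then (0 : ℝ) else ((((supNorm⟦n⟧ : ℕ) : ℝ)) ^ 2)⁻¹) ≤ 26 * (M : ℝ) := by
  induction M with
  | zero =>
      have h0 : cube⟦0⟧ = {0} := by
        ext n
        rw [mem_cube_iff, Finset.mem_singleton, Nat.le_zero, supNorm_eq_zero_iff]
      rw [h0, Finset.sum_singleton, if_pos rfl]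
      positivity
  | succ M ih =>
      rw [← Finset.sum_sdiff (cube_subset_cube_succ M)]
      -- on the shell `‖n‖∞ = M+1` every term is `1/(M+1)²`
      have hshell : ∀ n ∈ cube⟦M + 1⟧ \ cube⟦M⟧,
          (if n = 0 then (0 : ℝ) else ((((supNorm⟦n⟧ : ℕ) : ℝ)) ^ 2)⁻¹) = (((M : ℝ) + 1) ^ 2)⁻¹ := by
        intro n hn
        rw [Finset.mem_sdiff, mem_cube_iff, mem_cube_iff] at hn
        have hs : supNorm⟦n⟧ = M + 1 := by omega
        have hne : n ≠ 0 := by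
          intro h
          rw [(supNorm_eq_zero_iff n).2 h] at hs
          omega
        rw [if_neg hne, hs]
        push_cast
        rfl
      rw [Finset.sum_congr rfl hshell, Finset.sum_const, Finset.card_sdiff_of_subset
        (cube_subset_cube_succ M), card_cube, card_cube, nsmul_eq_mul]
      have hcard : (((2 * (M + 1) + 1) ^ 3 - (2 * M + 1) ^ 3 : ℕ) : ℝ) ≤ 26 * ((M : ℝ) + 1) ^ 2 := by
        have h1 : (2 * M + 1) ^ 3 ≤ (2 * (M + 1) + 1) ^ 3 := Nat.pow_le_pow_left (by omega) 3
        rw [Nat.cast_sub h1]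
        push_cast
        have hM0 : (0 : ℝ) ≤ M := Nat.cast_nonneg M
        nlinarith [hM0, sq_nonneg (M : ℝ)]
      have hM1 : (0 : ℝ) < (M : ℝ) + 1 := by positivity
      calc (((2 * (M + 1) + 1) ^ 3 - (2 * M + 1) ^ 3 : ℕ) : ℝ) * (((M : ℝ) + 1) ^ 2)⁻¹ +
            ∑ n ∈ cube⟦M⟧, (if n = 0 then (0 : ℝ) else ((((supNorm⟦n⟧ : ℕ) : ℝ)) ^ 2)⁻¹)
          ≤ 26 * ((M : ℝ) + 1) ^ 2 * (((M : ℝ) + 1) ^ 2)⁻¹ + 26 * (M : ℝ) := by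
            gcongr
        _ = 26 + 26 * (M : ℝ) := by field_simp
        _ = 26 * ((M + 1 : ℕ) : ℝ) := by push_cast; ring

/-- **The free-scale lattice sum.** For a weight `0 ≤ cₙ ≤ 1` on `ℤ³` with `∑ₙ ‖n‖² cₙ = A'`
(Euclidean norm `‖n‖ = ‖latticeVec 1 n‖`) and a cut-off `M ≥ 1`: every finite partial sum of
`∑_{n ≠ 0} cₙ/‖n‖²` is at most `26 M + A'/M⁴`. -/
theorem sum_weight_div_norm_sq_le {c : (Fin 3 → ℤ) → ℝ} (hc0 : ∀ n, 0 ≤ c n) (hc1 : ∀ n, c n ≤ 1)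
    {A' : ℝ} (hA : HasSum (fun n => ‖latticeVec 1 n‖ ^ 2 * c n) A') {M : ℕ} (hM : 1 ≤ M)
    (s : Finset (Fin 3 → ℤ)) :
    ∑ n ∈ s, (if n = 0 then 0 else c n / ‖latticeVec 1 n‖ ^ 2) ≤ 26 * (M : ℝ) + A' / (M : ℝ) ^ 4 := by
  classical
  have hMpos : (0 : ℝ) < M := by exact_mod_cast hM
  have hnn : ∀ n, 0 ≤ (if n = 0 then 0 else c n / ‖latticeVec 1 n‖ ^ 2) := fun n => by
    split_ifs
    · exact le_rfl
    · exact div_nonneg (hc0 n) (sq_nonneg _)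
  rw [← Finset.sum_filter_add_sum_filter_not s (fun n => supNorm⟦n⟧ ≤ M)]
  refine add_le_add ?_ ?_
  · -- infrared part: `cₙ ≤ 1`, `‖n‖ ≥ ‖n‖∞`, then the shell count
    calc ∑ n ∈ s.filter (fun n => supNorm⟦n⟧ ≤ M), (if n = 0 then 0 else c n / ‖latticeVec 1 n‖ ^ 2)
        ≤ ∑ n ∈ cube⟦M⟧, (if n = 0 then 0 else c n / ‖latticeVec 1 n‖ ^ 2) := by
          refine Finset.sum_le_sum_of_subset_of_nonneg (fun n hn => ?_) (fun n _ _ => hnn n)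
          rw [Finset.mem_filter] at hn
          exact (mem_cube_iff M n).2 hn.2
      _ ≤ ∑ n ∈ cube⟦M⟧, (if n = 0 then (0 : ℝ) else ((((supNorm⟦n⟧ : ℕ) : ℝ)) ^ 2)⁻¹) := by
          refine Finset.sum_le_sum fun n _ => ?_
          split_ifs with hn
          · exact le_rfl
          · have hs : 0 < ((supNorm⟦n⟧ : ℕ) : ℝ) := by
              have : supNorm⟦n⟧ ≠ 0 := fun h => hn ((supNorm_eq_zero_iff n).1 h)
              positivity
            have hs2 : 0 < ((supNorm⟦n⟧ : ℕ) : ℝ) ^ 2 := by positivity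
            have hle2 : ((supNorm⟦n⟧ : ℕ) : ℝ) ^ 2 ≤ ‖latticeVec 1 n‖ ^ 2 :=
              pow_le_pow_left₀ hs.le (supNorm_le_norm n) 2
            rw [div_le_iff₀ (lt_of_lt_of_le hs2 hle2)]
            calc c n ≤ 1 := hc1 n
              _ = (((supNorm⟦n⟧ : ℕ) : ℝ) ^ 2)⁻¹ * ((supNorm⟦n⟧ : ℕ) : ℝ) ^ 2 := by field_simp
              _ ≤ (((supNorm⟦n⟧ : ℕ) : ℝ) ^ 2)⁻¹ * ‖latticeVec 1 n‖ ^ 2 := by gcongr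
      _ ≤ 26 * (M : ℝ) := sum_cube_inv_supNorm_sq_le M
  · -- ultraviolet part: `1/‖n‖² ≤ ‖n‖²/M⁴` for `‖n‖∞ > M`
    calc ∑ n ∈ s.filter (fun n => ¬ supNorm⟦n⟧ ≤ M), (if n = 0 then 0 else c n / ‖latticeVec 1 n‖ ^ 2)
        ≤ ∑ n ∈ s.filter (fun n => ¬ supNorm⟦n⟧ ≤ M), ‖latticeVec 1 n‖ ^ 2 * c n / (M : ℝ) ^ 4 := by
          refine Finset.sum_le_sum fun n hn => ?_
          rw [Finset.mem_filter, not_le] at hn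
          have hne : n ≠ 0 := by
            intro h
            have := hn.2
            rw [(supNorm_eq_zero_iff n).2 h] at this
            omega
          rw [if_neg hne]
          have hMn : (M : ℝ) < ‖latticeVec 1 n‖ := by
            have h1 : ((M : ℕ) : ℝ) + 1 ≤ ((supNorm⟦n⟧ : ℕ) : ℝ) := by exact_mod_cast hn.2
            linarith [supNorm_le_norm n]
          have hnpos : 0 < ‖latticeVec 1 n‖ := hMpos.trans hMn
          rw [div_le_div_iff₀ (by positivity) (by positivity)]
          have h4 : (M : ℝ) ^ 4 ≤ ‖latticeVec 1 n‖ ^ 4 := by gcongr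
          calc c n * (M : ℝ) ^ 4 ≤ c n * ‖latticeVec 1 n‖ ^ 4 := by gcongr; exact hc0 n
            _ = ‖latticeVec 1 n‖ ^ 2 * c n * ‖latticeVec 1 n‖ ^ 2 := by ring
      _ = (∑ n ∈ s.filter (fun n => ¬ supNorm⟦n⟧ ≤ M), ‖latticeVec 1 n‖ ^ 2 * c n) / (M : ℝ) ^ 4 := by
          rw [Finset.sum_div]
      _ ≤ A' / (M : ℝ) ^ 4 := by
          gcongr
          exact sum_le_hasSum _ (fun n _ => mul_nonneg (sq_nonneg _) (hc0 n)) hA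

/-- **The free-scale lattice sum, `tsum` form**: under the same hypotheses the series
`∑_{n ≠ 0} cₙ/‖n‖²` is summable with sum at most `26 M + A'/M⁴`. -/
theorem tsum_weight_div_norm_sq_le {c : (Fin 3 → ℤ) → ℝ} (hc0 : ∀ n, 0 ≤ c n) (hc1 : ∀ n, c n ≤ 1)
    {A' : ℝ} (hA : HasSum (fun n => ‖latticeVec 1 n‖ ^ 2 * c n) A') {M : ℕ} (hM : 1 ≤ M) :
    Summable (fun n : Fin 3 → ℤ => if n = 0 then 0 else c n / ‖latticeVec 1 n‖ ^ 2) ∧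
      ∑' n : Fin 3 → ℤ, (if n = 0 then 0 else c n / ‖latticeVec 1 n‖ ^ 2) ≤
        26 * (M : ℝ) + A' / (M : ℝ) ^ 4 := by
  have hnn : ∀ n, 0 ≤ (if n = 0 then 0 else c n / ‖latticeVec 1 n‖ ^ 2) := fun n => by
    split_ifs
    · exact le_rfl
    · exact div_nonneg (hc0 n) (sq_nonneg _)
  exact ⟨summable_of_sum_le hnn (sum_weight_div_norm_sq_le hc0 hc1 hA hM),
    Real.tsum_le_of_sum_le hnn (sum_weight_div_norm_sq_le hc0 hc1 hA hM)⟩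

/-- **Registered sub-goal `freeScaleLatticeSum`** of crux stmt-AtomisticToContinuum-11784 (binder-free form of
`tsum_weight_div_norm_sq_le`, the `d = 3` free-scale lattice count): for a weight `0 ≤ c ≤ 1` on `ℤ³` with
`∑ ‖n‖² cₙ = A'` and a cut-off `M ≥ 1`, `∑_{n ≠ 0} cₙ/‖n‖² ≤ 26 M + A'/M⁴`. -/
theorem freeScaleLatticeSum : ∀ (c : (Fin 3 → ℤ) → ℝ), (∀ n, 0 ≤ c n) → (∀ n, c n ≤ 1) → ∀ (A' : ℝ),
    HasSum (fun n => ‖latticeVec 1 n‖ ^ 2 * c n) A' → ∀ (M : ℕ), 1 ≤ M →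
      ∑' n : Fin 3 → ℤ, (if n = 0 then 0 else c n / ‖latticeVec 1 n‖ ^ 2) ≤ 26 * (M : ℝ) + A' / (M : ℝ) ^ 4 :=
  fun _ hc0 hc1 _ hA _ hM => (tsum_weight_div_norm_sq_le hc0 hc1 hA hM).2

/-! ### The Lévy–Jensen–Parseval bound at the free scale -/

variable {L a θ B₁ B₃ : ℝ} {g : Space → ℝ}

/-- **The Lévy–Jensen–Parseval bound on the cell average of `log g`, free-scale form.** Let `g > 0`
be continuous on `ℝ³` with `g ≥ θ > 0` within `4a` of every corner `Lε` of the cell (`4a ≤ L`), and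
suppose the Lévy weights `νₙ = Re ĉₙ(log g)` satisfy `νₙ ≤ B₁ + B₃/‖n‖²` for `n ≠ 0`. Then
`log θ − (B₁ · 8Q₀L³/a³ + B₃ · (52 + 2Q₁/π²) L/a) ≤ L⁻³ ∫_cell log g`. -/
theorem log_sub_le_setAverage_log_sq (hL : 0 < L) (ha : 0 < a) (h4a : 4 * a ≤ L) (hθ : 0 < θ)
    (hB₁ : 0 ≤ B₁) (hB₃ : 0 ≤ B₃) (hg : Continuous g) (hpos : ∀ r, 0 < g r)
    (hnear : ∀ r : Space, (∃ ε ∈ corners, ‖r - latticeVec L ε‖ < 4 * a) → θ ≤ g r)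
    (hν : ∀ n : Fin 3 → ℤ, n ≠ 0 →
      (cellFourierCoeff L (fun r : Space => ((Real.log (g r) : ℝ) : ℂ)) n).re ≤
        B₁ + B₃ / ‖latticeVec 1 n‖ ^ 2) :
    Real.log θ - (B₁ * (8 * Q₀ * L ^ 3 / a ^ 3) + B₃ * ((52 + 2 * Q₁ / Real.pi ^ 2) * L / a))
      ≤ (L ^ 3)⁻¹ * ∫ r in cell L, Real.log (g r) := by
  have h2a : 2 * a ≤ L := by linarith
  have h3a : 3 * a ≤ L := by linarith
  have haL : a ≤ L := by linarith
  -- the objects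
  set ψ : Space → ℂ := fun r => ((Real.log (g r) : ℝ) : ℂ) with hψ
  set E : (Fin 3 → ℤ) → ℂ := fun n => ∫ x, conj (cellWave L n x) * ((ηv⟦a, x⟧ : ℝ) : ℂ) with hE
  set c : (Fin 3 → ℤ) → ℝ := fun n => ‖E n‖ ^ 2 with hc
  set ν : (Fin 3 → ℤ) → ℝ := fun n => (cellFourierCoeff L ψ n).re with hνdef
  set φ : Space → ℝ := fun r => ∑ ε ∈ corners, φ₀v⟦a, r - latticeVec L ε⟧ with hφ
  have hψc : Continuous ψ := continuous_ofReal.comp (hg.log fun r => (hpos r).ne')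
  have hφc : Continuous φ := continuous_kernel ha L
  have hc0 : ∀ n, 0 ≤ c n := fun n => sq_nonneg _
  have hc1 : ∀ n, c n ≤ 1 := fun n => by
    have h := norm_integral_conj_cellWave_mul_bump_le ha L n
    rw [hc]
    nlinarith [norm_nonneg (E n)]
  have hcz : c 0 = 1 := by
    simp only [hc, hE, integral_conj_cellWave_zero_mul_bump ha L, norm_one, one_pow]
  -- Step 1: Parseval against the kernel, real parts, times `L³`
  have hP := hasSum_conj_cellFourierCoeff_mul hL (continuous_cornerSum L (continuous_autocorr ha)) hψc
  simp only [cellFourierCoeff_kernel hL ha h4a, Complex.conj_ofReal] at hP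
  have hinner : ∫ r in cell L, conj (∑ ε ∈ corners, ((φ₀v⟦a, r - latticeVec L ε⟧ : ℝ) : ℂ)) * ψ r =
      ((∫ r in cell L, φ r * Real.log (g r) : ℝ) : ℂ) := by
    rw [← integral_complex_ofReal]
    refine integral_congr_ae (Eventually.of_forall fun r => ?_)
    simp only [hψ, hφ, map_sum, Complex.conj_ofReal]
    push_cast
    ring
  rw [hinner] at hP
  have hL3 : (L ^ 3) ≠ 0 := by positivity
  have hT : HasSum (fun n => c n * ν n) (∫ r in cell L, φ r * Real.log (g r)) := by
    refine hasSum_congr_both ((hP.mapL Complex.reCLM).mul_left (L ^ 3)) (fun n => ?_) ?_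
    · simp only [Complex.reCLM_apply, Complex.re_ofReal_mul, hc, hνdef, hE]
      field_simp
    · simp only [Complex.reCLM_apply, Complex.real_smul, Complex.re_ofReal_mul, Complex.ofReal_re]
      field_simp
  -- Step 2: split off `n = 0`: `ν₀ = L⁻³ ∫ log g`, `c₀ = 1`
  have hν0 : ν 0 = (L ^ 3)⁻¹ * ∫ r in cell L, Real.log (g r) := by
    simp only [hνdef, cellFourierCoeff_zero hL, hψ, integral_complex_ofReal, Complex.real_smul,
      Complex.re_ofReal_mul, Complex.ofReal_re]
  classical
  have hR : HasSum (fun n => if n = 0 then 0 else c n * ν n)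
      ((∫ r in cell L, φ r * Real.log (g r)) - ν 0) := by
    have h := hT.update 0 0
    rw [hcz, one_mul, zero_sub, neg_add_eq_sub] at h
    refine h.congr_fun fun n => ?_
    by_cases hn : n = 0
    · subst hn; simp
    · simp [hn]
  -- Step 3: the kernel sees only the good region: `∫ φ log g ≥ log θ`
  have hmain : Real.log θ ≤ ∫ r in cell L, φ r * Real.log (g r) := by
    have hpt : ∀ r, φ r * Real.log θ ≤ φ r * Real.log (g r) := by
      intro r
      by_cases hr : φ r = 0
      · rw [hr, zero_mul, zero_mul]
      · exact mul_le_mul_of_nonneg_left (Real.log_le_log hθ (hnear r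
          (exists_corner_of_kernel_ne_zero ha hr))) (kernel_nonneg ha L r)
    calc Real.log θ = ∫ r in cell L, φ r * Real.log θ := by
          rw [integral_mul_const, setIntegral_kernel ha h4a, one_mul]
      _ ≤ ∫ r in cell L, φ r * Real.log (g r) :=
          setIntegral_mono_on (integrableOn_cell (hφc.mul continuous_const))
            (integrableOn_cell (hφc.mul (hg.log fun r => (hpos r).ne'))) (measurableSet_cell L)
            (fun r _ => hpt r)
  -- Step 4: the remainder is bounded by the two Parseval sums and the free-scale lattice count
  obtain ⟨S₀, hS₀, hS₀le⟩ := exists_hasSum_norm_sq_bumpCoeff hL ha h2a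
  obtain ⟨S₁, hS₁, hS₁le⟩ := exists_hasSum_norm_sq_mul_norm_sq_bumpCoeff hL ha h3a
  set M : ℕ := ⌈L / a⌉₊ with hM
  have hLa : 1 ≤ L / a := by rw [le_div_iff₀ ha]; linarith
  have hM1 : 1 ≤ M := Nat.one_le_iff_ne_zero.2 (Nat.ceil_pos.2 (by positivity)).ne'
  have hMle : (M : ℝ) ≤ 2 * (L / a) := by
    have := Nat.ceil_lt_add_one (by positivity : 0 ≤ L / a)
    rw [← hM] at this
    linarith
  have hMge : L / a ≤ (M : ℝ) := Nat.le_ceil _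
  obtain ⟨hlsum, hlle⟩ := tsum_weight_div_norm_sq_le hc0 hc1 hS₁ hM1
  have hmaj : HasSum (fun n => B₁ * c n + B₃ * (if n = 0 then 0 else c n / ‖latticeVec 1 n‖ ^ 2))
      (B₁ * S₀ + B₃ * ∑' n, (if n = 0 then 0 else c n / ‖latticeVec 1 n‖ ^ 2)) :=
    (hS₀.mul_left B₁).add (hlsum.hasSum.mul_left B₃)
  have hRle : (∫ r in cell L, φ r * Real.log (g r)) - ν 0 ≤
      B₁ * S₀ + B₃ * ∑' n, (if n = 0 then 0 else c n / ‖latticeVec 1 n‖ ^ 2) := by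
    refine hasSum_le (fun n => ?_) hR hmaj
    by_cases hn : n = 0
    · simp only [hn, ↓reduceIte, mul_zero, add_zero]
      exact mul_nonneg hB₁ (hc0 0)
    · simp only [hn, ↓reduceIte]
      have h := mul_le_mul_of_nonneg_left (hν n hn) (hc0 n)
      calc c n * ν n ≤ c n * (B₁ + B₃ / ‖latticeVec 1 n‖ ^ 2) := h
        _ = B₁ * c n + B₃ * (c n / ‖latticeVec 1 n‖ ^ 2) := by ring
  -- Step 5: arithmetic of the cut-off `M = ⌈L/a⌉`
  have hS₁nn : 0 ≤ S₁ := hS₁.nonneg fun n => mul_nonneg (sq_nonneg _) (hc0 n)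
  have hlat : ∑' n, (if n = 0 then 0 else c n / ‖latticeVec 1 n‖ ^ 2) ≤
      (52 + 2 * Q₁ / Real.pi ^ 2) * L / a := by
    refine hlle.trans ?_
    have hpi : 0 < Real.pi := Real.pi_pos
    have h1 : 26 * (M : ℝ) ≤ 52 * L / a := by
      rw [le_div_iff₀ (by positivity)]
      have : (M : ℝ) * a ≤ 2 * L := by
        have := mul_le_mul_of_nonneg_right hMle ha.le
        rwa [mul_assoc, div_mul_cancel₀ _ ha.ne'] at this
      nlinarith [this]
    have h2 : S₁ / (M : ℝ) ^ 4 ≤ (2 * Q₁ / Real.pi ^ 2) * L / a := by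
      have hM4 : (L / a) ^ 4 ≤ (M : ℝ) ^ 4 := by gcongr
      calc S₁ / (M : ℝ) ^ 4 ≤ S₁ / (L / a) ^ 4 := by gcongr
        _ ≤ ((L / (2 * Real.pi)) ^ 2 * (8 * L ^ 3 * ((a ^ 5)⁻¹ * Q₁))) / (L / a) ^ 4 := by
            gcongr
        _ = (2 * Q₁ / Real.pi ^ 2) * L / a := by
            field_simp
            ring
    calc 26 * (M : ℝ) + S₁ / (M : ℝ) ^ 4
        ≤ 52 * L / a + (2 * Q₁ / Real.pi ^ 2) * L / a := add_le_add h1 h2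
      _ = (52 + 2 * Q₁ / Real.pi ^ 2) * L / a := by ring
  have hS₀' : B₁ * S₀ ≤ B₁ * (8 * Q₀ * L ^ 3 / a ^ 3) := by
    refine mul_le_mul_of_nonneg_left (hS₀le.trans (le_of_eq ?_)) hB₁
    field_simp
  have hfin := add_le_add hS₀' (mul_le_mul_of_nonneg_left hlat hB₃)
  rw [← hν0]
  linarith

/-- **The Lévy–Jensen–Parseval bound on the cell average of `g`, free-scale form**: under the
hypotheses of `log_sub_le_setAverage_log_sq`, `θ · exp(−error) ≤ L⁻³ ∫_cell g`. -/
theorem mul_exp_neg_le_setAverage_sq (hL : 0 < L) (ha : 0 < a) (h4a : 4 * a ≤ L) (hθ : 0 < θ)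
    (hB₁ : 0 ≤ B₁) (hB₃ : 0 ≤ B₃) (hg : Continuous g) (hpos : ∀ r, 0 < g r)
    (hnear : ∀ r : Space, (∃ ε ∈ corners, ‖r - latticeVec L ε‖ < 4 * a) → θ ≤ g r)
    (hν : ∀ n : Fin 3 → ℤ, n ≠ 0 →
      (cellFourierCoeff L (fun r : Space => ((Real.log (g r) : ℝ) : ℂ)) n).re ≤
        B₁ + B₃ / ‖latticeVec 1 n‖ ^ 2) :
    θ * Real.exp (-(B₁ * (8 * Q₀ * L ^ 3 / a ^ 3) +
        B₃ * ((52 + 2 * Q₁ / Real.pi ^ 2) * L / a))) ≤ (L ^ 3)⁻¹ * ∫ r in cell L, g r := by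
  have h1 := log_sub_le_setAverage_log_sq hL ha h4a hθ hB₁ hB₃ hg hpos hnear hν
  have h2 := setAverage_log_le_log_setAverage hL hg hpos
  obtain ⟨m, hm, hmle⟩ := exists_pos_le_on_cell hL hg hpos
  have havgpos : 0 < (L ^ 3)⁻¹ * ∫ r in cell L, g r := by
    refine mul_pos (by positivity) ?_
    have hvol : volume (cell L) = ENNReal.ofReal (L ^ 3) := by
      rw [volume_cell, ENNReal.ofReal_pow hL.le]
    calc (0 : ℝ) < m * L ^ 3 := by positivity
      _ = ∫ _ in cell L, m := by
          rw [setIntegral_const, Measure.real, hvol, ENNReal.toReal_ofReal (by positivity),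
            smul_eq_mul, mul_comm]
      _ ≤ ∫ r in cell L, g r := setIntegral_mono_on (integrableOn_cell continuous_const)
          (integrableOn_cell hg) (measurableSet_cell L) hmle
  rw [← Real.exp_log hθ, ← Real.exp_add, ← Real.exp_log havgpos]
  exact Real.exp_le_exp.2 (by linarith)

end Summit.AtomisticToContinuum.BoseEinsteinCondensation.Theorems.IMUChainGlue

end
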